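/-
Copyright: the b2b-balaban T⁴-continuum CRUX team, row NE7b OWNER lineage `t4-ne7b-p1` (gen 139). Project licence.
-/
import Summits.QuantumFields.BalabanUV.T4Continuum.Spine.NE7b.SupDobrushinNeumannMatrix

/-!
# THE DECAY RATE OF DOBRUSHIN'S MATRIX — exponentially weighted Neumann letters (SCOPING (d11)(1)): for a nonnegative `C` and a
# SUBMULTIPLICATIVE WEIGHT `θ ≥ 1` (`θ_{xz} ≤ θ_{xy}θ_{yz}`, e.g. `θ_{xz} = e^{μd(x,z)}` for a semimetric `d`) with the WEIGHTED row letter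
# `Σ_z C_{xz}θ_{xz} ≤ γ_θ < 1`, the powers obey `Σ_z (C^n)_{xz}θ_{xz} ≤ γ_θ^n`, so the Neumann matrix `D = Σ_nC^n` of (448) has the weighted
# row letter `Σ_z D_{xz}θ_{xz} ≤ (1−γ_θ)⁻¹` and the ENTRY DECAY `D_{xz} ≤ (1−γ_θ)⁻¹∕θ_{xz}` — with (447) `abs_cov_le_kernel_gibbs` the
# covariance kernel of the Gibbs law then decays like `θ⁻¹` off the diagonal (Gross∕Künsch∕Föllmer's rate, LNM 1362 (2.14)∕(2.24))
# (row NE7b, node U5c; (448) BY NAME; [folklore])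

Cell `pub-balaban`, sub-cell `t4`, spine estimate NE7b (`T4WeightBudget.RelWeightBound`; the cell's OWN estimate — NOT PRINTED in
[Bałaban 1983–89], NOT PROVED).  Crux-route work under `Spine/NE7b/` by the row OWNER (`t4-ne7b-p1` gen 139, file (453)) under FREEZE
(0)'s crux-prover clause; NOTHING of Bałaban's is named as a Lean object, valued or asserted; no `T4Continuum/Support` leaf typed; no
`def`, no notation; zero `sorry`.  Imports (BY NAME): the OWNER's (448) `…SupDobrushinNeumannMatrix` (`pow_entry_nonneg`, `summable_pow_entry`).

WHAT IS PROVED ([folklore]; `C : Matrix ι ι ℝ`, `θ : ι → ι → ℝ`, `hθ1 : 1 ≤ θ_{xz}`, `hθdiag : θ_{xx} = 1`, `hθmul : θ_{xz} ≤ θ_{xy}θ_{yz}`,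
`hCθ : Σ_zC_{xz}θ_{xz} ≤ γ_θ`):
* §1 `rowsum_le_weighted` (`Σ_zC_{xz} ≤ γ_θ`: the plain letter follows), **`pow_weighted_rowsum_le`** (`Σ_z(C^n)_{xz}θ_{xz} ≤ γ_θ^n`),
  `pow_entry_weighted_le` (`(C^n)_{xz}θ_{xz} ≤ γ_θ^n`).
* §2 **`neumann_weighted_rowsum_le`** (`Σ_z D_{xz}θ_{xz} ≤ (1−γ_θ)⁻¹`), **`neumann_entry_decay`** (`D_{xz} ≤ (1−γ_θ)⁻¹∕θ_{xz}`).
* §3 toy (kernel): the trivial weight `θ = 1` is admissible (`1 ≤ 1`, `1 ≤ 1·1`).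

HONEST (what this is NOT).  The weight is abstract; for the road `θ_{xz} = e^{μd(x,z)}` with `d` the block∕cell distance and `μ` small
enough that the finite-range `C` keeps `Σ_zC_{xz}e^{μd} < 1` — that choice and the resulting decay of (450)'s covariance kernel are the
successor's ((d11)(2)).  Scalar skeleton ((A3), NC-NE7b-α UNRULED); nothing of Bałaban's asserted.  BY-NAME EFFECT ON THE WALL: NONE.  NE7b
NOT PRINTED ∕ NOT PROVED; spine PROVED 0∕9; rung (B)+1 — the programme's measures remain FINITE-torus statements; NOT the mass gap, NOT
Clay.  HONEST DEPENDENCY: continuum YM on T⁴ ⇐ BetaPertH ∧ nine spine estimates (0∕9 proved); BetaPertH ⇐ (D1) ∧ (D4) ∧ CAP+tail; G-an2-4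
gates asym, D1 and NE2∕3∕4.
-/

set_option autoImplicit false

noncomputable section

namespace Summit.QuantumFields.BalabanUV.T4Continuum.NE7b.SupDobrushinWeightedNeumann

open Finset
open scoped BigOperators
open SupDobrushinNeumannMatrix (pow_entry_nonneg summable_pow_entry)

variable {ι : Type} [Fintype ι] [DecidableEq ι]

variable {C : Matrix ι ι ℝ} {θ : ι → ι → ℝ} {γθ : ℝ}

/-! ## §1. Weighted row letters of the powers -/

omit [DecidableEq ι] in
/-- The plain row letter follows from the weighted one (`θ ≥ 1`, `C ≥ 0`). [folklore] -/
theorem rowsum_le_weighted (hC : ∀ x z, 0 ≤ C x z) (hθ1 : ∀ x z, 1 ≤ θ x z) (hCθ : ∀ x, ∑ z, C x z * θ x z ≤ γθ) (x : ι) :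
    ∑ z, C x z ≤ γθ :=
  (Finset.sum_le_sum fun z _ => by simpa using mul_le_mul_of_nonneg_left (hθ1 x z) (hC x z)).trans (hCθ x)

/-- **THE WEIGHTED ROW LETTER OF THE POWERS**: `Σ_z (C^n)_{xz}θ_{xz} ≤ γ_θ^n` (submultiplicativity of `θ` along each hop; `θ_{xx} = 1`).
[folklore] -/
theorem pow_weighted_rowsum_le (hC : ∀ x z, 0 ≤ C x z) (hθ1 : ∀ x z, 1 ≤ θ x z) (hθdiag : ∀ x, θ x x = 1)
    (hθmul : ∀ x y z, θ x z ≤ θ x y * θ y z) (hCθ : ∀ x, ∑ z, C x z * θ x z ≤ γθ) : ∀ (n : ℕ) (x : ι), ∑ z, (C ^ n) x z * θ x z ≤ γθ ^ n := by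
  intro n
  induction n with
  | zero =>
    intro x
    rw [pow_zero, pow_zero]
    have e : ∀ z, (1 : Matrix ι ι ℝ) x z * θ x z = if z = x then θ x x else 0 := fun z => by
      rw [Matrix.one_apply]
      by_cases h : x = z
      · subst h; simp
      · have h' : ¬ z = x := fun e => h e.symm
        simp [h, h']
    simp_rw [e]
    rw [Finset.sum_ite_eq' Finset.univ x, if_pos (Finset.mem_univ x), hθdiag x]
  | succ n ih =>
    intro x
    have hγ : 0 ≤ γθ := le_trans (Finset.sum_nonneg fun z _ => mul_nonneg (hC x z) (zero_le_one.trans (hθ1 x z))) (hCθ x)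
    calc ∑ z, (C ^ (n + 1)) x z * θ x z = ∑ z, (∑ y, (C ^ n) x y * C y z) * θ x z :=
          Finset.sum_congr rfl fun z _ => by rw [pow_succ, Matrix.mul_apply]
      _ ≤ ∑ z, ∑ y, (C ^ n) x y * θ x y * (C y z * θ y z) := by
          refine Finset.sum_le_sum fun z _ => ?_
          rw [Finset.sum_mul]
          refine Finset.sum_le_sum fun y _ => ?_
          have h := mul_le_mul_of_nonneg_left (hθmul x y z) (mul_nonneg (pow_entry_nonneg hC n x y) (hC y z))
          calc (C ^ n) x y * C y z * θ x z ≤ (C ^ n) x y * C y z * (θ x y * θ y z) := h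
            _ = (C ^ n) x y * θ x y * (C y z * θ y z) := by ring
      _ = ∑ y, (C ^ n) x y * θ x y * ∑ z, C y z * θ y z := by
          rw [Finset.sum_comm]; exact Finset.sum_congr rfl fun y _ => by rw [Finset.mul_sum]
      _ ≤ ∑ y, (C ^ n) x y * θ x y * γθ := Finset.sum_le_sum fun y _ =>
          mul_le_mul_of_nonneg_left (hCθ y) (mul_nonneg (pow_entry_nonneg hC n x y) (zero_le_one.trans (hθ1 x y)))
      _ ≤ γθ ^ n * γθ := by rw [← Finset.sum_mul]; exact mul_le_mul_of_nonneg_right (ih x) hγ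
      _ = γθ ^ (n + 1) := by rw [pow_succ]

/-- A weighted entry is at most the weighted row sum: `(C^n)_{xz}θ_{xz} ≤ γ_θ^n`. [folklore] -/
theorem pow_entry_weighted_le (hC : ∀ x z, 0 ≤ C x z) (hθ1 : ∀ x z, 1 ≤ θ x z) (hθdiag : ∀ x, θ x x = 1)
    (hθmul : ∀ x y z, θ x z ≤ θ x y * θ y z) (hCθ : ∀ x, ∑ z, C x z * θ x z ≤ γθ) (n : ℕ) (x z : ι) : (C ^ n) x z * θ x z ≤ γθ ^ n :=
  (Finset.single_le_sum (f := fun z => (C ^ n) x z * θ x z)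
    (fun y _ => mul_nonneg (pow_entry_nonneg hC n x y) (zero_le_one.trans (hθ1 x y))) (Finset.mem_univ z)).trans
    (pow_weighted_rowsum_le hC hθ1 hθdiag hθmul hCθ n x)

/-! ## §2. The weighted letters of the Neumann matrix -/

/-- **THE WEIGHTED ROW LETTER OF `D = Σ_nC^n`**: `Σ_z D_{xz}θ_{xz} ≤ (1−γ_θ)⁻¹` (`0 ≤ γ_θ < 1`). [folklore] -/
theorem neumann_weighted_rowsum_le (hC : ∀ x z, 0 ≤ C x z) (hθ1 : ∀ x z, 1 ≤ θ x z) (hθdiag : ∀ x, θ x x = 1)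
    (hθmul : ∀ x y z, θ x z ≤ θ x y * θ y z) (hCθ : ∀ x, ∑ z, C x z * θ x z ≤ γθ) (hγ0 : 0 ≤ γθ) (hγ1 : γθ < 1) (x : ι) :
    ∑ z, (∑' n : ℕ, (C ^ n) x z) * θ x z ≤ (1 - γθ)⁻¹ := by
  have hrow := rowsum_le_weighted hC hθ1 hCθ
  have hs := summable_pow_entry hC hrow hγ0 hγ1
  have e : ∀ z, (∑' n : ℕ, (C ^ n) x z) * θ x z = ∑' n : ℕ, (C ^ n) x z * θ x z := fun z => ((hs x z).tsum_mul_right (θ x z)).symm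
  simp_rw [e]
  rw [← Summable.tsum_finsetSum fun z _ => (hs x z).mul_right (θ x z), ← tsum_geometric_of_lt_one hγ0 hγ1]
  exact Summable.tsum_le_tsum (fun n => pow_weighted_rowsum_le hC hθ1 hθdiag hθmul hCθ n x)
    (summable_sum fun z _ => (hs x z).mul_right (θ x z)) (summable_geometric_of_lt_one hγ0 hγ1)

/-- **THE ENTRY DECAY OF `D`**: `D_{xz} ≤ (1−γ_θ)⁻¹∕θ_{xz}`, i.e. `D_{xz}θ_{xz} ≤ (1−γ_θ)⁻¹`. [folklore] -/
theorem neumann_entry_decay (hC : ∀ x z, 0 ≤ C x z) (hθ1 : ∀ x z, 1 ≤ θ x z) (hθdiag : ∀ x, θ x x = 1)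
    (hθmul : ∀ x y z, θ x z ≤ θ x y * θ y z) (hCθ : ∀ x, ∑ z, C x z * θ x z ≤ γθ) (hγ0 : 0 ≤ γθ) (hγ1 : γθ < 1) (x z : ι) :
    (∑' n : ℕ, (C ^ n) x z) ≤ (1 - γθ)⁻¹ / θ x z := by
  have hθ0 : 0 < θ x z := zero_lt_one.trans_le (hθ1 x z)
  rw [le_div_iff₀ hθ0]
  have hrow := rowsum_le_weighted hC hθ1 hCθ
  have hs := summable_pow_entry hC hrow hγ0 hγ1
  refine le_trans (Finset.single_le_sum (f := fun z => (∑' n : ℕ, (C ^ n) x z) * θ x z)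
    (fun y _ => mul_nonneg (tsum_nonneg fun n => pow_entry_nonneg hC n x y) (zero_le_one.trans (hθ1 x y))) (Finset.mem_univ z)) ?_
  exact neumann_weighted_rowsum_le hC hθ1 hθdiag hθmul hCθ hγ0 hγ1 x

/-! ## §3. Toy instance (kernel) -/

/-- Toy: the trivial weight `θ ≡ 1` is admissible: `1 ≤ 1`, `θ_{xx} = 1`, `1 ≤ 1·1`. -/
example : (∀ x z : Fin 3, (1 : ℝ) ≤ (fun _ _ : Fin 3 => (1 : ℝ)) x z) ∧ (∀ x : Fin 3, (fun _ _ : Fin 3 => (1 : ℝ)) x x = 1) ∧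
    (∀ x y z : Fin 3, (fun _ _ : Fin 3 => (1 : ℝ)) x z ≤ (fun _ _ : Fin 3 => (1 : ℝ)) x y * (fun _ _ : Fin 3 => (1 : ℝ)) y z) := by
  refine ⟨fun _ _ => le_rfl, fun _ => rfl, fun _ _ _ => by norm_num⟩

end Summit.QuantumFields.BalabanUV.T4Continuum.NE7b.SupDobrushinWeightedNeumann

end
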